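import Summits.NavierStokesRegularity.NavierStokesRegularity.Theorems.ExtremiserTransienceDecayingSharpConstant
import HarnessLib

/-!
# Route `ExtremiserTransience`, item `GalileanGainLeTwo` (stmt-NavierStokesRegularity-26688) — PROVED

`--workitem stmt-NavierStokesRegularity-26688`.  Author: prover seat `ns-el-k1b` (g2).

A homogeneous-class field with drift `c` at infinity obeys the sharp inequality with constant `2κ⋆`: modus ponens of
the landed `DepletionLadder.GalileanGauge.galileanGainLeTwo_of_decaying` with `DecayingSharpConstant`
(stmt-26687, `decayingSharpConstant_proof`).  (In fact the constant `κ⋆` itself holds: `HomogeneousSharpConstant`.)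

WHAT THIS IS NOT: a static inequality on admissible fields; rung N0 and NS regularity stay OPEN — nothing here proves
NS regularity. [folklore]
-/

noncomputable section

namespace Summit.NavierStokesRegularity.NavierStokesRegularity.Theorems

-- the problem directory repeats the summit name (`NavierStokesRegularity/NavierStokesRegularity`)
set_option linter.dupNamespace false

/-- **`GalileanGainLeTwo` (stmt-NavierStokesRegularity-26688) holds.** [folklore] -/
theorem galileanGainLeTwo_proof :
    Summit.NavierStokesRegularity.NavierStokesRegularity.Theses.ExtremiserTransience.GalileanGainLeTwo :=
  DepletionLadder.GalileanGauge.galileanGainLeTwo_of_decaying decayingSharpConstant_proof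

end Summit.NavierStokesRegularity.NavierStokesRegularity.Theorems

end
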